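import Mathlib
import HarnessLib
import Summits.ValiantsHypothesis.ValiantsHypothesis.Theorems.LacunarySymmetroidMatrixDescartesOsculationLawRecursionWitnessDiagonal
import Summits.ValiantsHypothesis.ValiantsHypothesis.Theorems.LacunarySymmetroidMatrixDescartesOsculationLawUniformDictionary
import Summits.ValiantsHypothesis.ValiantsHypothesis.Theorems.LacunarySymmetroidMatrixDescartesOsculationLawUniformGeneric

/-!
# ValiantsHypothesis / LacunarySymmetroid — crux `MatrixDescartes` (stmt-ValiantsHypothesis-18050, V1),
# line `Cruxes/MatrixDescartes/Lines/osculation_law.lean` («osculation-law»), stub `stub_recursion`, R6(a) witness: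
# THE RESULTANT CERTIFICATE OF A PENCIL OF DIAGONAL LETTERS

The Zariski form of «the osculation set is finite» that the ROUTE′ density proof transports along a segment is
`Res_b(toBiv Φ, toBiv H(Φ)) ≢ 0` (val-lit-p5 g12's currency: `toBiv Φ = MvPolynomial.aeval ![C X, X] Φ ∈ ℝ[t][b]`,
✓ `OsculationUniform.eval_map_toBiv`, ✓ `finite_bad_eps_resultant`; val-port-3 g1's spec, bus l.8171/8185).  For a
pencil of DIAGONAL letters on `Fin m ⊕ Fin 0` with one-sign, non-crossing, log-convex branches
(`…RecursionWitnessDiagonal.diagonal_fibre_simple`) this certificate HOLDS — for EVERY member of val-lit-p6 g14's generic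
diagonal witness family (positive entries, distinct within each letter; bus l.8220/8228), not only the proportional one:
* `eq_of_forall_map_evalRingHom_eq` — a bivariate real polynomial is determined by its fibres;
* `map_toBiv_diagonal` — every fibre of `toBiv Φ` is `Π_i (X − β_i(t))`, monic of degree `|Fin m ⊕ Fin 0|`;
* `resultant_toBiv_ne_zero_of_diagonal(')` — `Res_b(toBiv Φ, toBiv H(Φ)) ≠ 0`, by p5 g12's
  `OsculationUniform.resultant_ne_zero_of_fibre'` at a fibre `t₀ > 0` where the branches are pairwise distinct (it
  splits, and shares no root with the fibre of `H(Φ)` by fibre simplicity); the primed form finds `t₀` itself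
  (`exists_pos_forall_sum_ne`: the branches may CROSS elsewhere — crossings are osculation points, harmless here);
* `resultant_toBiv_C_mul_ne_zero` — the certificate is insensitive to a nonzero constant factor `κ·Φ`.
Honest framing: helper lemmas toward the OPEN stub `stub_recursion` (its general-position residue); the osculation
LAW, `MatrixDescartes`, Conjecture B and `VP ≠ VNP` are NOT proved.  No definitions, no named facts.  (val-lit-p4
g13, helper `--supports stmt-ValiantsHypothesis-18050`.)
-/

-- `Summit.ValiantsHypothesis.ValiantsHypothesis.…` is the tree's mandated single-conjunct layout (Sub = Summit).
set_option linter.dupNamespace false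

noncomputable section

namespace Summit.ValiantsHypothesis.ValiantsHypothesis.Theorems.LacunarySymmetroidMatrixDescartes

open Polynomial Set
open MvPolynomial (pderiv)
open scoped BigOperators Matrix

namespace OsculationRecursion

/-- A bivariate real polynomial is determined by its fibres `t = const`. [folklore] -/
theorem eq_of_forall_map_evalRingHom_eq (P Q : ℝ[X][X]) (h : ∀ t : ℝ, P.map (evalRingHom t) = Q.map (evalRingHom t)) :
    P = Q := by
  ext n : 1
  refine Polynomial.funext fun t => ?_
  have h1 := congrArg (fun q => q.coeff n) (h t)
  simpa only [coeff_map, coe_evalRingHom] using h1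

/-- **The fibres of `toBiv Φ` for a pencil of diagonal letters**: `(toBiv Φ)(t, ·) = Π_i (X − β_i(t))`,
`β_i(t) = Σ_l A_{i,l} t^{e_l}`. [folklore] -/
theorem map_toBiv_diagonal (m : ℕ) {K : ℕ} (e : Fin K → ℕ) (A : (Fin m ⊕ Fin 0) → Fin K → ℝ)
    (S : Fin K → Matrix (Fin m ⊕ Fin 0) (Fin m ⊕ Fin 0) ℝ) (hS : ∀ l, S l = Matrix.diagonal fun i => -A i l)
    (Φ : MvPolynomial (Fin 2) ℝ)
    (hΦ : Φ = (∑ l, (MvPolynomial.X (0 : Fin 2) : MvPolynomial (Fin 2) ℝ) ^ e l •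
          (S l).map (MvPolynomial.C : ℝ →+* MvPolynomial (Fin 2) ℝ)
        + (MvPolynomial.X (1 : Fin 2) : MvPolynomial (Fin 2) ℝ) •
          (Matrix.fromBlocks 1 0 0 0 : Matrix (Fin m ⊕ Fin 0) (Fin m ⊕ Fin 0) ℝ).map
            (MvPolynomial.C : ℝ →+* MvPolynomial (Fin 2) ℝ)).det) (t : ℝ) :
    (MvPolynomial.aeval (![Polynomial.C Polynomial.X, Polynomial.X] : Fin 2 → ℝ[X][X]) Φ).map (evalRingHom t) =
      ∏ i, (X - Polynomial.C (∑ l, A i l * t ^ e l)) := by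
  refine Polynomial.funext fun b => ?_
  rw [OsculationUniform.eval_map_toBiv, hΦ, eval_det_mvPencil_diagonal m e A S hS, eval_prod]
  simp only [Matrix.cons_val_one, Matrix.cons_val_zero, eval_sub, eval_X, eval_C]

/-- **The resultant certificate** `Res_b(toBiv Φ, toBiv H(Φ)) ≠ 0` for a pencil of diagonal letters with one-sign rows
(two nonzero entries at distinct exponents) and pairwise non-crossing branches. [folklore] -/
theorem resultant_toBiv_ne_zero_of_diagonal (m : ℕ) {K : ℕ} (e : Fin K → ℕ) (A : (Fin m ⊕ Fin 0) → Fin K → ℝ)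
    (S : Fin K → Matrix (Fin m ⊕ Fin 0) (Fin m ⊕ Fin 0) ℝ) (hS : ∀ l, S l = Matrix.diagonal fun i => -A i l)
    (Φ : MvPolynomial (Fin 2) ℝ)
    (hΦ : Φ = (∑ l, (MvPolynomial.X (0 : Fin 2) : MvPolynomial (Fin 2) ℝ) ^ e l •
          (S l).map (MvPolynomial.C : ℝ →+* MvPolynomial (Fin 2) ℝ)
        + (MvPolynomial.X (1 : Fin 2) : MvPolynomial (Fin 2) ℝ) •
          (Matrix.fromBlocks 1 0 0 0 : Matrix (Fin m ⊕ Fin 0) (Fin m ⊕ Fin 0) ℝ).map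
            (MvPolynomial.C : ℝ →+* MvPolynomial (Fin 2) ℝ)).det)
    (hsign : ∀ i, ∃ l₁ l₂, e l₁ ≠ e l₂ ∧
      (((∀ l, 0 ≤ A i l) ∧ 0 < A i l₁ ∧ 0 < A i l₂) ∨ ((∀ l, A i l ≤ 0) ∧ A i l₁ < 0 ∧ A i l₂ < 0)))
    (t₀ : ℝ) (ht₀ : 0 < t₀) (hsep : ∀ i j, i ≠ j → ∑ l, A i l * t₀ ^ e l ≠ ∑ l, A j l * t₀ ^ e l) :
    resultant (MvPolynomial.aeval (![Polynomial.C Polynomial.X, Polynomial.X] : Fin 2 → ℝ[X][X]) Φ)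
      (MvPolynomial.aeval (![Polynomial.C Polynomial.X, Polynomial.X] : Fin 2 → ℝ[X][X])
        (MvPolynomial.X 0 * MvPolynomial.pderiv 0 (MvPolynomial.X 0 * MvPolynomial.pderiv 0 Φ)
            * (MvPolynomial.X 1 * MvPolynomial.pderiv 1 Φ) ^ 2
          - 2 * (MvPolynomial.X 0 * MvPolynomial.pderiv 0 (MvPolynomial.X 1 * MvPolynomial.pderiv 1 Φ))
            * (MvPolynomial.X 0 * MvPolynomial.pderiv 0 Φ) * (MvPolynomial.X 1 * MvPolynomial.pderiv 1 Φ)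
          + MvPolynomial.X 1 * MvPolynomial.pderiv 1 (MvPolynomial.X 1 * MvPolynomial.pderiv 1 Φ)
            * (MvPolynomial.X 0 * MvPolynomial.pderiv 0 Φ) ^ 2)) ≠ 0 := by
  set P := MvPolynomial.aeval (![Polynomial.C Polynomial.X, Polynomial.X] : Fin 2 → ℝ[X][X]) Φ with hP
  -- every fibre is the monic product `Π_i (X − β_i(t))`, of degree `N = |Fin m ⊕ Fin 0|`
  have hfib : ∀ t : ℝ, P.map (evalRingHom t) = ∏ i, (X - Polynomial.C (∑ l, A i l * t ^ e l)) :=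
    fun t => map_toBiv_diagonal m e A S hS Φ hΦ t
  set N : ℕ := Fintype.card (Fin m ⊕ Fin 0) with hN
  have hmonic : ∀ t : ℝ, (∏ i : Fin m ⊕ Fin 0, (X - Polynomial.C (∑ l, A i l * t ^ e l))).Monic := fun t =>
    monic_prod_of_monic _ _ fun i _ => monic_X_sub_C _
  have hdeg : ∀ t : ℝ, (∏ i : Fin m ⊕ Fin 0, (X - Polynomial.C (∑ l, A i l * t ^ e l))).natDegree = N := by
    intro t
    rw [natDegree_prod_of_monic _ _ fun i _ => monic_X_sub_C _]
    simp only [natDegree_X_sub_C, Finset.sum_const, Finset.card_univ, smul_eq_mul, mul_one, hN]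
  have hPN : P.natDegree ≤ N := by
    refine natDegree_le_iff_coeff_eq_zero.2 fun n hn => Polynomial.funext fun t => ?_
    have h1 : (P.coeff n).eval t = (P.map (evalRingHom t)).coeff n := by rw [coeff_map, coe_evalRingHom]
    rw [h1, hfib t, eval_zero]
    exact coeff_eq_zero_of_natDegree_lt (by rw [hdeg t]; exact hn)
  have htop : (P.coeff N).eval t₀ ≠ 0 := by
    have h1 : (P.coeff N).eval t₀ = (P.map (evalRingHom t₀)).coeff N := by rw [coeff_map, coe_evalRingHom]
    rw [h1, hfib t₀, ← hdeg t₀, (hmonic t₀).coeff_natDegree]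
    exact one_ne_zero
  have hsplit : (P.map (evalRingHom t₀)).Splits := by
    rw [hfib t₀]; exact Splits.prod fun i _ => Splits.X_sub_C _
  refine OsculationUniform.resultant_ne_zero_of_fibre' P _ N hPN t₀ htop hsplit fun b hb hHb => ?_
  rw [IsRoot.def, hP, OsculationUniform.eval_map_toBiv] at hb
  rw [IsRoot.def, OsculationUniform.eval_map_toBiv] at hHb
  exact (diagonal_fibre_simple m e A S hS Φ hΦ hsign ht₀ hsep hb).2 hHb

/-- **The resultant certificate, abscissa found automatically**: distinct exponents and pairwise-different rows
suffice (`exists_pos_forall_sum_ne`). [folklore] -/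
theorem resultant_toBiv_ne_zero_of_diagonal' (m : ℕ) {K : ℕ} (e : Fin K → ℕ) (he : Function.Injective e)
    (A : (Fin m ⊕ Fin 0) → Fin K → ℝ) (hA : ∀ i j, i ≠ j → ∃ l, A i l ≠ A j l)
    (S : Fin K → Matrix (Fin m ⊕ Fin 0) (Fin m ⊕ Fin 0) ℝ) (hS : ∀ l, S l = Matrix.diagonal fun i => -A i l)
    (Φ : MvPolynomial (Fin 2) ℝ)
    (hΦ : Φ = (∑ l, (MvPolynomial.X (0 : Fin 2) : MvPolynomial (Fin 2) ℝ) ^ e l •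
          (S l).map (MvPolynomial.C : ℝ →+* MvPolynomial (Fin 2) ℝ)
        + (MvPolynomial.X (1 : Fin 2) : MvPolynomial (Fin 2) ℝ) •
          (Matrix.fromBlocks 1 0 0 0 : Matrix (Fin m ⊕ Fin 0) (Fin m ⊕ Fin 0) ℝ).map
            (MvPolynomial.C : ℝ →+* MvPolynomial (Fin 2) ℝ)).det)
    (hsign : ∀ i, ∃ l₁ l₂, e l₁ ≠ e l₂ ∧
      (((∀ l, 0 ≤ A i l) ∧ 0 < A i l₁ ∧ 0 < A i l₂) ∨ ((∀ l, A i l ≤ 0) ∧ A i l₁ < 0 ∧ A i l₂ < 0))) :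
    resultant (MvPolynomial.aeval (![Polynomial.C Polynomial.X, Polynomial.X] : Fin 2 → ℝ[X][X]) Φ)
      (MvPolynomial.aeval (![Polynomial.C Polynomial.X, Polynomial.X] : Fin 2 → ℝ[X][X])
        (MvPolynomial.X 0 * MvPolynomial.pderiv 0 (MvPolynomial.X 0 * MvPolynomial.pderiv 0 Φ)
            * (MvPolynomial.X 1 * MvPolynomial.pderiv 1 Φ) ^ 2
          - 2 * (MvPolynomial.X 0 * MvPolynomial.pderiv 0 (MvPolynomial.X 1 * MvPolynomial.pderiv 1 Φ))
            * (MvPolynomial.X 0 * MvPolynomial.pderiv 0 Φ) * (MvPolynomial.X 1 * MvPolynomial.pderiv 1 Φ)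
          + MvPolynomial.X 1 * MvPolynomial.pderiv 1 (MvPolynomial.X 1 * MvPolynomial.pderiv 1 Φ)
            * (MvPolynomial.X 0 * MvPolynomial.pderiv 0 Φ) ^ 2)) ≠ 0 := by
  obtain ⟨t₀, ht₀, hsep⟩ := exists_pos_forall_sum_ne e he A hA
  exact resultant_toBiv_ne_zero_of_diagonal m e A S hS Φ hΦ hsign t₀ ht₀ hsep

/-- **Constant factors do not affect the certificate**: `Res_b(toBiv(κΦ), toBiv H(κΦ)) ≠ 0` iff the same for `Φ`
(`H(κΦ) = κ³H(Φ)`, val-lit-p5 g12's `OsculationUniform.logHessian_C_mul`). Used to pass between the congruent node-2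
pencils `Y⁻ᵀ(·)Y⁻¹` of DIFFERENT square roots `Y` of the same `YᵀY` (`OsculationUniform.insertionPoly_inv_congr`).
[folklore] -/
theorem resultant_toBiv_C_mul_ne_zero (κ : ℝ) (hκ : κ ≠ 0) (Φ : MvPolynomial (Fin 2) ℝ)
    (h : resultant (MvPolynomial.aeval (![Polynomial.C Polynomial.X, Polynomial.X] : Fin 2 → ℝ[X][X]) Φ)
      (MvPolynomial.aeval (![Polynomial.C Polynomial.X, Polynomial.X] : Fin 2 → ℝ[X][X])
        (MvPolynomial.X 0 * MvPolynomial.pderiv 0 (MvPolynomial.X 0 * MvPolynomial.pderiv 0 Φ)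
            * (MvPolynomial.X 1 * MvPolynomial.pderiv 1 Φ) ^ 2
          - 2 * (MvPolynomial.X 0 * MvPolynomial.pderiv 0 (MvPolynomial.X 1 * MvPolynomial.pderiv 1 Φ))
            * (MvPolynomial.X 0 * MvPolynomial.pderiv 0 Φ) * (MvPolynomial.X 1 * MvPolynomial.pderiv 1 Φ)
          + MvPolynomial.X 1 * MvPolynomial.pderiv 1 (MvPolynomial.X 1 * MvPolynomial.pderiv 1 Φ)
            * (MvPolynomial.X 0 * MvPolynomial.pderiv 0 Φ) ^ 2)) ≠ 0) :
    resultant (MvPolynomial.aeval (![Polynomial.C Polynomial.X, Polynomial.X] : Fin 2 → ℝ[X][X])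
        (MvPolynomial.C κ * Φ))
      (MvPolynomial.aeval (![Polynomial.C Polynomial.X, Polynomial.X] : Fin 2 → ℝ[X][X])
        (MvPolynomial.X 0 * MvPolynomial.pderiv 0 (MvPolynomial.X 0 * MvPolynomial.pderiv 0 (MvPolynomial.C κ * Φ))
            * (MvPolynomial.X 1 * MvPolynomial.pderiv 1 (MvPolynomial.C κ * Φ)) ^ 2
          - 2 * (MvPolynomial.X 0 * MvPolynomial.pderiv 0
              (MvPolynomial.X 1 * MvPolynomial.pderiv 1 (MvPolynomial.C κ * Φ)))
            * (MvPolynomial.X 0 * MvPolynomial.pderiv 0 (MvPolynomial.C κ * Φ))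
            * (MvPolynomial.X 1 * MvPolynomial.pderiv 1 (MvPolynomial.C κ * Φ))
          + MvPolynomial.X 1 * MvPolynomial.pderiv 1 (MvPolynomial.X 1 * MvPolynomial.pderiv 1 (MvPolynomial.C κ * Φ))
            * (MvPolynomial.X 0 * MvPolynomial.pderiv 0 (MvPolynomial.C κ * Φ)) ^ 2)) ≠ 0 := by
  rw [OsculationUniform.logHessian_C_mul κ Φ, ← map_pow, map_mul, map_mul, MvPolynomial.algHom_C,
    MvPolynomial.algHom_C, Polynomial.algebraMap_apply, Polynomial.algebraMap_eq, Polynomial.algebraMap_apply,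
    Polynomial.algebraMap_eq]
  rw [natDegree_C_mul (Polynomial.C_ne_zero.2 hκ), natDegree_C_mul (Polynomial.C_ne_zero.2 (pow_ne_zero 3 hκ)),
    resultant_C_mul_left, resultant_C_mul_right]
  exact mul_ne_zero (pow_ne_zero _ (Polynomial.C_ne_zero.2 hκ))
    (mul_ne_zero (pow_ne_zero _ (Polynomial.C_ne_zero.2 (pow_ne_zero 3 hκ))) h)

end OsculationRecursion

end Summit.ValiantsHypothesis.ValiantsHypothesis.Theorems.LacunarySymmetroidMatrixDescartes

end
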